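import Mathlib.RingTheory.Nakayama
import Mathlib.RingTheory.LocalRing.RingHom.Basic
import Mathlib.RingTheory.Noetherian.Basic
import HarnessLib

/-!
# Cotangent surjectivity forces `𝔪_R S = 𝔪_S` (Nakayama; the infinitesimal form of unramifiedness, Stacks 02FM / 00UV)

Topic `Literature/RingTheory/Etale`, namespace `Literature.RingTheory.Etale`.  THEOREMS ONLY (no definition, no
named fact, no `sorry`).  Cell `hodgecm-mathlib`, fan B-III (T3) = binder I-1′ (item 24835), v4 `stub_S2imm` Step C,
F1b-0 = the Nakayama step between the analytic input («the cotangent map is onto», i.e. `𝔪_S ⊆ 𝔪_R S + 𝔪_S²`) and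
the hypothesis of ★ `formallyUnramified_of_forall_isClosed_map_maximalIdeal` (`𝔪_R S = 𝔪_S`).  Banked leaf; no floor
change.

For a local homomorphism `φ : R → S` of local rings with `𝔪_S` finitely generated (e.g. `S` Noetherian):
`𝔪_S ≤ 𝔪_R S + 𝔪_S²  ⟹  𝔪_R S = 𝔪_S` (`map_maximalIdeal_eq_of_le_sup_sq`), and conversely (`le_sup_sq_of_map_maximalIdeal_eq`,
trivial) — i.e. `𝔪_R S = 𝔪_S` iff the cotangent map `𝔪_R → 𝔪_S / 𝔪_S²` is onto.

## References
* The Stacks Project, Tag 00DV (Nakayama (4)), Tag 02FM, Tag 00UV. [StacksProject]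
* A. Grothendieck, EGA IV₄ (Publ. Math. IHÉS 32, 1967), Cor. 17.4.2. [Grothendieck1967]
-/

set_option autoImplicit false

namespace Literature.RingTheory.Etale

open IsLocalRing

variable {R S : Type*} [CommRing R] [CommRing S] [IsLocalRing R] [IsLocalRing S] (φ : R →+* S)

/-- A local homomorphism maps the maximal ideal into the maximal ideal. [cite: StacksProject, Tag 00UV] -/
theorem map_maximalIdeal_le [IsLocalHom φ] : (maximalIdeal R).map φ ≤ maximalIdeal S :=
  ((local_hom_TFAE φ).out 0 2).mp ‹IsLocalHom φ›

/-- **Cotangent surjectivity forces `𝔪_R S = 𝔪_S`** (Nakayama): for a local homomorphism `φ : R → S` of local rings with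
`𝔪_S` finitely generated, if `𝔪_S ⊆ 𝔪_R S + 𝔪_S²` — i.e. the cotangent map `𝔪_R → 𝔪_S/𝔪_S²` is onto — then
`𝔪_R S = 𝔪_S`.  This is the infinitesimal half of «unramified at the closed point» ([Stacks 02FM]); with
`Algebra.FormallyUnramified.of_map_maximalIdeal` it gives formal unramifiedness.
[cite: StacksProject, Tags 00DV (4) and 02FM] [cite: Grothendieck1967, Cor. 17.4.2] -/
theorem map_maximalIdeal_eq_of_le_sup_sq [IsLocalHom φ] (hfg : (maximalIdeal S).FG)
    (h : maximalIdeal S ≤ (maximalIdeal R).map φ ⊔ (maximalIdeal S) ^ 2) :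
    (maximalIdeal R).map φ = maximalIdeal S := by
  refine le_antisymm (map_maximalIdeal_le φ) ?_
  -- Nakayama: `N' = 𝔪_S`, `N = 𝔪_R S`, `I = 𝔪_S ≤ jacobson ⊥`
  refine Submodule.le_of_le_smul_of_le_jacobson_bot hfg (maximalIdeal_le_jacobson (⊥ : Ideal S)) ?_
  rwa [Ideal.smul_eq_mul, ← pow_two]

/-- The Noetherian case of `map_maximalIdeal_eq_of_le_sup_sq`. [cite: StacksProject, Tag 02FM] -/
theorem map_maximalIdeal_eq_of_le_sup_sq_of_isNoetherianRing [IsLocalHom φ] [IsNoetherianRing S]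
    (h : maximalIdeal S ≤ (maximalIdeal R).map φ ⊔ (maximalIdeal S) ^ 2) :
    (maximalIdeal R).map φ = maximalIdeal S :=
  map_maximalIdeal_eq_of_le_sup_sq φ (IsNoetherian.noetherian _) h

/-- Conversely `𝔪_R S = 𝔪_S` trivially gives `𝔪_S ≤ 𝔪_R S + 𝔪_S²`. [cite: StacksProject, Tag 02FM] -/
theorem le_sup_sq_of_map_maximalIdeal_eq (h : (maximalIdeal R).map φ = maximalIdeal S) :
    maximalIdeal S ≤ (maximalIdeal R).map φ ⊔ (maximalIdeal S) ^ 2 :=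
  h ▸ le_sup_left

end Literature.RingTheory.Etale
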